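import Summits.Ventures.HodgeRepro2.T6A2Theta
import Summits.Ventures.HodgeRepro2.T6A2Conj
import Summits.Ventures.HodgeRepro2.T6A2Projector
import Summits.Ventures.HodgeRepro2.A2Galois

/-!
# T6A2Proj — sub-claim A2 on the explicit model: the Lagrange projectors `P_{Λ,S}([x]^*_ℂ)` on the plane
generators (LEMMA A4.2.2 after `⊗ ℂ`), the non-vanishing of the planes, and the ℂ-span of the complexified
`H²(A_i, ℚ)` (the inputs of the avoidance step (A4.2.7))

Cell pub-hodge-repro2, Tier 6 (README §10), seat t6-p2 (A2 owner). Layer II over `T6Interface` v0 through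
`T6A2Model` / `T6A2Theta` / `T6A2Conj`; imports the ACCEPTED `T6A2Projector` (`aeval_apply_of_mem_eigenspace`)
and p6's `A2Galois` (`lagrangeIndicator`, `lagrangeIndicator_eval`). Definition lane: `pairVal`, `proj1`,
`projW`.

* `planeGen_mem_eigenspace` — `E_{g,g'}` is an eigenvector of `[x]^*_ℂ` with eigenvalue `τ₁(g(x)g'(x))`;
  `planeGen_diag`, `planeGen_swap`; `eval_map_lagrangeIndicator_ringHom`.
* `aeval_sum_planeGen`, `aeval_lagrange_sum_planeGen` — a Lagrange polynomial in `[x]^*_ℂ` keeps exactly the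
  plane generators whose eigenvalue lies in the selected set (Lemma A4.2.2: `p_2 ⊗ ℂ` is the projector onto
  `⊕_ν ℓ_{i,τ_ν} ∧ ℓ_{i,τ̄_ν}`).
* `ι_mul_ι_ne_zero_of_notMem_span` (a 2 × 2 determinant functional through `ExteriorAlgebra.liftAlternating`),
  `notMem_span_singleton_of_ne`, `planeGen_ne_zero` — the plane `E_{g,g'}`, `g ≠ g'`, is non-zero (distinct
  eigenlines are not proportional).
* `gen1C_mem_span_extC_gen1`, `gen1C_mul_gen1C_mem_span` — every plane generator lies in the ℂ-span of the
  complexified rational `H²(A_i, ℚ)` (why the coordinate functionals of (A4.2.7) are non-zero on `D_i`).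
* `proj1 K τ₁ x g` (the coordinate projector onto the conjugate-pair plane of `g`), `projW K τ₁ x` (the
  projector onto the three conjugate-pair planes); `proj1_sum_planeGen`, `projW_eq_sum_proj1` — their action
  on a combination of plane generators for a separating `x` and a half-system `τ` of the pairs.

No `sorry`; standard axioms.
-/

namespace Summit.Ventures.HodgeRepro2.T6.A2Proj

open Summit.Ventures.HodgeRepro2.T6 Summit.Ventures.HodgeRepro2.T6.A2Model
  Summit.Ventures.HodgeRepro2.T6.A2Theta Summit.Ventures.HodgeRepro2.T6.A2Conj NumberField Polynomial

variable (K : Type*) [Field K] [NumberField K] [IsCMField K]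

section projector

variable (τ₁ : K →+* ℂ) (e : (K ≃ₐ[ℚ] K) → KC K)

omit [IsCMField K] in
/-- The plane generator `E_{g,g'}` is an eigenvector of `[x]^*_ℂ` with eigenvalue `τ₁(g(x) g'(x))`. -/
theorem planeGen_mem_eigenspace (he : ∀ g, e g ∈ eigenLineK K (emb K τ₁ g)) (x : K) (i : Fin 4)
    (p : (K ≃ₐ[ℚ] K) × (K ≃ₐ[ℚ] K)) :
    planeGen K e i p ∈ Module.End.eigenspace (pullEndoC K x).toLinearMap (τ₁ (p.1 x * p.2 x)) := by
  have h := ι_mul_ι_mem_eigenspace K x (single_mem_eigenLine K i (he p.1))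
    (single_mem_eigenLine K i (he p.2))
  rw [emb_apply, emb_apply, ← map_mul] at h
  unfold planeGen gen1C
  exact h

omit [IsCMField K] in
/-- The plane generator of a pair `(g, g)` vanishes. -/
theorem planeGen_diag (i : Fin 4) (g : K ≃ₐ[ℚ] K) : planeGen K e i (g, g) = 0 :=
  ExteriorAlgebra.ι_sq_zero _

omit [IsCMField K] in
/-- `E_{g',g} = −E_{g,g'}`. -/
theorem planeGen_swap (i : Fin 4) (g g' : K ≃ₐ[ℚ] K) :
    planeGen K e i (g', g) = -planeGen K e i (g, g') := by
  rw [eq_neg_iff_add_eq_zero, add_comm]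
  exact ExteriorAlgebra.ι_add_mul_swap _ _

omit [NumberField K] [IsCMField K] in
/-- The value of a Lagrange polynomial over `K`, read in `ℂ` through `τ₁`, at the image of a node. -/
theorem eval_map_lagrangeIndicator_ringHom [DecidableEq K] (Λ ΛW : Finset K) {l : K} (hl : l ∈ Λ) :
    ((Summit.Ventures.HodgeRepro2.A2Galois.lagrangeIndicator Λ ΛW).map τ₁).eval (τ₁ l) =
      if l ∈ ΛW then 1 else 0 := by
  rw [eval_map, eval₂_hom, Summit.Ventures.HodgeRepro2.A2Galois.lagrangeIndicator_eval Λ ΛW l hl]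
  split_ifs <;> simp



omit [IsCMField K] in
/-- A polynomial in `[x]^*_ℂ` acts on a combination of plane generators through its values at the
eigenvalues. -/
theorem aeval_sum_planeGen (he : ∀ g, e g ∈ eigenLineK K (emb K τ₁ g)) (x : K) (i : Fin 4) (P : K[X])
    (a : (K ≃ₐ[ℚ] K) × (K ≃ₐ[ℚ] K) → ℂ) :
    aeval (pullEndoC K x).toLinearMap (P.map τ₁) (∑ p, a p • planeGen K e i p) =
      ∑ p, (a p * (P.map τ₁).eval (τ₁ (p.1 x * p.2 x))) • planeGen K e i p := by
  rw [map_sum]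
  refine Finset.sum_congr rfl fun p _ => ?_
  rw [map_smul, Summit.Ventures.HodgeRepro2.T6.A2Projector.aeval_apply_of_mem_eigenspace _ (planeGen_mem_eigenspace K τ₁ e he x i p), smul_smul]

omit [IsCMField K] in
/-- The Lagrange projector `P_{Λ,S}([x]^*_ℂ)` keeps exactly the plane generators whose eigenvalue lies
in `S` (the diagonal generators vanish anyway). -/
theorem aeval_lagrange_sum_planeGen [DecidableEq K] [DecidableEq (K ≃ₐ[ℚ] K)]
    (he : ∀ g, e g ∈ eigenLineK K (emb K τ₁ g)) (x : K) (i : Fin 4) (S : Finset K)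
    (a : (K ≃ₐ[ℚ] K) × (K ≃ₐ[ℚ] K) → ℂ) :
    aeval (pullEndoC K x).toLinearMap
        ((Summit.Ventures.HodgeRepro2.A2Galois.lagrangeIndicator (Lam K x) S).map τ₁)
        (∑ p, a p • planeGen K e i p) =
      ∑ p, (if p.1 ≠ p.2 ∧ p.1 x * p.2 x ∈ S then a p else 0) • planeGen K e i p := by
  rw [aeval_sum_planeGen K τ₁ e he]
  refine Finset.sum_congr rfl fun p _ => ?_
  by_cases hp : p.1 = p.2
  · have h0 : planeGen K e i p = 0 := by
      obtain ⟨g, g'⟩ := p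
      simp only at hp
      subst hp
      exact planeGen_diag K e i g
    rw [h0, smul_zero, smul_zero]
  · rw [eval_map_lagrangeIndicator_ringHom K τ₁ _ _ (mem_Lam_of_ne K x hp)]
    simp only [hp, ne_eq, not_false_eq_true, true_and]
    split_ifs <;> simp

end projector

end Summit.Ventures.HodgeRepro2.T6.A2Proj

namespace Summit.Ventures.HodgeRepro2.T6.A2Proj

open Summit.Ventures.HodgeRepro2.T6 Summit.Ventures.HodgeRepro2.T6.A2Model
  Summit.Ventures.HodgeRepro2.T6.A2Theta Summit.Ventures.HodgeRepro2.T6.A2Conj NumberField Polynomial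

variable (K : Type*) [Field K] [NumberField K] [IsCMField K]

section wedge

/-- A wedge of two vectors neither of which lies on the line of the other is non-zero
(via a 2 × 2 determinant functional, `ExteriorAlgebra.liftAlternating`). -/
theorem ι_mul_ι_ne_zero_of_notMem_span {E : Type*} [AddCommGroup E] [Module ℂ E] {u v : E}
    (hu : u ∉ Submodule.span ℂ {v}) (hv : v ∉ Submodule.span ℂ {u}) :
    ExteriorAlgebra.ι ℂ u * ExteriorAlgebra.ι ℂ v ≠ 0 := by
  obtain ⟨φ, hφu, hφ⟩ := Submodule.exists_dual_map_eq_bot_of_notMem hu inferInstance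
  obtain ⟨ψ, hψv, hψ⟩ := Submodule.exists_dual_map_eq_bot_of_notMem hv inferInstance
  have hφv : φ v = 0 := by
    have : φ v ∈ (Submodule.span ℂ {v}).map φ := ⟨v, Submodule.mem_span_singleton_self v, rfl⟩
    rw [hφ] at this; simpa using this
  have hψu : ψ u = 0 := by
    have : ψ u ∈ (Submodule.span ℂ {u}).map ψ := ⟨u, Submodule.mem_span_singleton_self u, rfl⟩
    rw [hψ] at this; simpa using this
  let L : E →ₗ[ℂ] (Fin 2 → ℂ) := LinearMap.pi ![φ, ψ]
  let f₂ : E [⋀^Fin 2]→ₗ[ℂ] ℂ :=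
    (Matrix.detRowAlternating : (Fin 2 → ℂ) [⋀^Fin 2]→ₗ[ℂ] ℂ).compLinearMap L
  let F : ∀ i : ℕ, E [⋀^Fin i]→ₗ[ℂ] ℂ := fun i => match i with
    | 2 => f₂
    | _ => 0
  have h1 : ExteriorAlgebra.ι ℂ u * ExteriorAlgebra.ι ℂ v = ExteriorAlgebra.ιMulti ℂ 2 ![u, v] := by
    simp [ExteriorAlgebra.ιMulti_apply]
  have h2 : ExteriorAlgebra.liftAlternating F (ExteriorAlgebra.ιMulti ℂ 2 ![u, v]) = φ u * ψ v := by
    rw [ExteriorAlgebra.liftAlternating_apply_ιMulti]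
    show Matrix.detRowAlternating (fun i => L (![u, v] i)) = φ u * ψ v
    have hdet : Matrix.detRowAlternating (fun i => L (![u, v] i)) =
        Matrix.det (Matrix.of fun i => L (![u, v] i)) := rfl
    rw [hdet, Matrix.det_fin_two]
    simp [L, hφv, hψu]
  intro h
  rw [h1] at h
  have := congrArg (ExteriorAlgebra.liftAlternating F) h
  rw [h2, map_zero] at this
  exact mul_ne_zero hφu hψv this

end wedge

section independence

variable (τ₁ : K →+* ℂ) (e : (K ≃ₐ[ℚ] K) → KC K)

omit [IsCMField K] in
/-- Generators of distinct eigenlines are not proportional. -/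
theorem notMem_span_singleton_of_ne (he : ∀ g, e g ∈ eigenLineK K (emb K τ₁ g)) (hne : ∀ g, e g ≠ 0)
    {g g' : K ≃ₐ[ℚ] K} (hgg : g ≠ g') : e g ∉ Submodule.span ℂ {e g'} := by
  intro hmem
  obtain ⟨c, hc⟩ := Submodule.mem_span_singleton.mp hmem
  have hemb : emb K τ₁ g ≠ emb K τ₁ g' := fun h => hgg (emb_injective K τ₁ h)
  obtain ⟨y, hy⟩ := DFunLike.ne_iff.mp hemb
  have h1 := he g y
  have h2 := he g' y
  rw [← hc, Algebra.mul_smul_comm, h2, smul_comm, hc] at h1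
  have h3 : (emb K τ₁ g' y - emb K τ₁ g y) • e g = 0 := by rw [sub_smul, h1, sub_self]
  rcases smul_eq_zero.mp h3 with h4 | h4
  · exact hy (sub_eq_zero.mp h4).symm
  · exact hne g h4

omit [IsCMField K] in
/-- The plane generator of two DISTINCT embeddings is non-zero. -/
theorem planeGen_ne_zero (he : ∀ g, e g ∈ eigenLineK K (emb K τ₁ g)) (hne : ∀ g, e g ≠ 0) (i : Fin 4)
    {g g' : K ≃ₐ[ℚ] K} (hgg : g ≠ g') : planeGen K e i (g, g') ≠ 0 := by
  have key : ∀ {a b : KC K}, a ∉ Submodule.span ℂ {b} →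
      LinearMap.single ℂ (fun _ => KC K) i a ∉
        Submodule.span ℂ {LinearMap.single ℂ (fun _ => KC K) i b} := by
    intro a b hab hmem
    apply hab
    obtain ⟨c, hc⟩ := Submodule.mem_span_singleton.mp hmem
    refine Submodule.mem_span_singleton.mpr ⟨c, ?_⟩
    have := congrArg (fun f => f i) hc
    simpa using this
  exact ι_mul_ι_ne_zero_of_notMem_span
    (key (notMem_span_singleton_of_ne K τ₁ e he hne hgg))
    (key (notMem_span_singleton_of_ne K τ₁ e he hne hgg.symm))

end independence

section spanC

variable (i : Fin 4)

omit [IsCMField K] in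
/-- `c ⊗ a = c • (1 ⊗ a)` in `K ⊗ ℂ`. -/
theorem tmul_eq_smul_includeRight (c : ℂ) (a : K) :
    (c ⊗ₜ[ℚ] a : KC K) = c • (Algebra.TensorProduct.includeRight a : KC K) := by
  rw [Algebra.TensorProduct.includeRight_apply, TensorProduct.smul_tmul', smul_eq_mul, mul_one]

omit [IsCMField K] in
/-- Every vertex generator `ι(single i w)`, `w ∈ K ⊗ ℂ`, is a ℂ-combination of the complexified rational
generators `extC (ι(single i a))`, `a ∈ K`. -/
theorem gen1C_mem_span_extC_gen1 (w : KC K) :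
    gen1C K i w ∈ Submodule.span ℂ (Set.range fun a : K => extC K (gen1 K i a)) := by
  induction w using TensorProduct.induction_on with
  | zero => rw [← gen1CL_apply, map_zero]; exact Submodule.zero_mem _
  | tmul c a =>
    rw [tmul_eq_smul_includeRight, ← gen1CL_apply, map_smul, gen1CL_apply, ← extC_gen1]
    exact Submodule.smul_mem _ _ (Submodule.subset_span ⟨a, rfl⟩)
  | add w w' hw hw' =>
    rw [← gen1CL_apply, map_add]
    exact Submodule.add_mem _ hw hw'

omit [IsCMField K] in
/-- A product of two vertex generators lies in the ℂ-span of the complexified `H²(A_i, ℚ)`. -/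
theorem gen1C_mul_gen1C_mem_span (w w' : KC K) :
    gen1C K i w * gen1C K i w' ∈
      Submodule.span ℂ ((extC K) '' (vertexH2 K i : Set (HB K))) := by
  have h := Submodule.mul_mem_mul (gen1C_mem_span_extC_gen1 K i w) (gen1C_mem_span_extC_gen1 K i w')
  rw [Submodule.span_mul_span] at h
  refine Submodule.span_mono ?_ h
  rintro _ ⟨_, ⟨a, rfl⟩, _, ⟨b, rfl⟩, rfl⟩
  exact ⟨gen1 K i a * gen1 K i b, gen1_mul_gen1_mem_vertexH2 K i a b, map_mul _ _ _⟩

end spanC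

end Summit.Ventures.HodgeRepro2.T6.A2Proj

namespace Summit.Ventures.HodgeRepro2.T6.A2Proj

open Summit.Ventures.HodgeRepro2.T6 Summit.Ventures.HodgeRepro2.T6.A2Model
  Summit.Ventures.HodgeRepro2.T6.A2Theta Summit.Ventures.HodgeRepro2.T6.A2Conj NumberField Polynomial

variable (K : Type*) [Field K] [NumberField K] [IsCMField K]
variable [DecidableEq K] [DecidableEq (K ≃ₐ[ℚ] K)]
variable (τ₁ : K →+* ℂ)

/-- The conjugate-pair eigenvalue `λ_g = g(x) · (cc∘g)(x) ∈ K`. -/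
noncomputable abbrev pairVal (x : K) (g : K ≃ₐ[ℚ] K) : K := g x * ((cc K).trans g) x

/-- The coordinate projector `π_g = P_{Λ,{λ_g}}([x]^*_ℂ)` onto the conjugate-pair plane of `g`
(TIER4 (A4.2.7): the coordinate functional `λ_{i,ν}`). -/
noncomputable def proj1 (x : K) (g : K ≃ₐ[ℚ] K) : HBC K →ₗ[ℂ] HBC K :=
  aeval (pullEndoC K x).toLinearMap
    ((Summit.Ventures.HodgeRepro2.A2Galois.lagrangeIndicator (Lam K x) {pairVal K x g}).map τ₁)

/-- The projector `P_{Λ,Λ_W}([x]^*_ℂ)` onto the three conjugate-pair planes (TIER4 Lemma A4.2.2, `p_2 ⊗ ℂ`). -/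
noncomputable def projW (x : K) : HBC K →ₗ[ℂ] HBC K :=
  aeval (pullEndoC K x).toLinearMap
    ((Summit.Ventures.HodgeRepro2.A2Galois.lagrangeIndicator (Lam K x) (LamW K x)).map τ₁)

variable (e : (K ≃ₐ[ℚ] K) → KC K)

/-- `π_{g₀}` on a combination of plane generators: only the two ordered pairs of `{g₀, cc∘g₀}` survive. -/
theorem proj1_sum_planeGen (he : ∀ g, e g ∈ eigenLineK K (emb K τ₁ g)) {x : K} (hx : Separates K x)
    (g₀ : K ≃ₐ[ℚ] K) (i : Fin 4) (a : (K ≃ₐ[ℚ] K) × (K ≃ₐ[ℚ] K) → ℂ) :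
    proj1 K τ₁ x g₀ (∑ p, a p • planeGen K e i p) =
      (a (g₀, (cc K).trans g₀) - a ((cc K).trans g₀, g₀)) • planeGen K e i (g₀, (cc K).trans g₀) := by
  rw [proj1, aeval_lagrange_sum_planeGen K τ₁ e he]
  have hcond : ∀ p : (K ≃ₐ[ℚ] K) × (K ≃ₐ[ℚ] K),
      (p.1 ≠ p.2 ∧ p.1 x * p.2 x ∈ ({pairVal K x g₀} : Finset K)) ↔
        p = (g₀, (cc K).trans g₀) ∨ p = ((cc K).trans g₀, g₀) := by
    intro p
    constructor
    · rintro ⟨hp, hmem⟩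
      exact hx g₀ p hp (Finset.mem_singleton.mp hmem).symm
    · rintro (rfl | rfl)
      · exact ⟨(cc_trans_ne K g₀).symm, Finset.mem_singleton_self _⟩
      · exact ⟨cc_trans_ne K g₀, Finset.mem_singleton.mpr (mul_comm _ _)⟩
  have hsum : ∀ p, (if p.1 ≠ p.2 ∧ p.1 x * p.2 x ∈ ({pairVal K x g₀} : Finset K) then a p else 0) •
      planeGen K e i p =
      if p ∈ ({(g₀, (cc K).trans g₀), ((cc K).trans g₀, g₀)} : Finset _) then
        a p • planeGen K e i p else 0 := by
    intro p
    by_cases h : p.1 ≠ p.2 ∧ p.1 x * p.2 x ∈ ({pairVal K x g₀} : Finset K)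
    · rw [if_pos h, if_pos]
      rcases (hcond p).mp h with h' | h'
      · rw [h']; simp
      · rw [h']; simp
    · rw [if_neg h, zero_smul, if_neg]
      intro hmem
      apply h
      rw [hcond]
      simp only [Finset.mem_insert, Finset.mem_singleton] at hmem
      exact hmem
  simp_rw [hsum]
  rw [← Finset.sum_filter, Finset.filter_mem_eq_inter, Finset.univ_inter]
  have hne : (g₀, (cc K).trans g₀) ≠ ((cc K).trans g₀, g₀) := by
    intro h
    exact cc_trans_ne K g₀ (congrArg Prod.fst h).symm
  rw [Finset.sum_pair hne, planeGen_swap K e i g₀ ((cc K).trans g₀), smul_neg, sub_smul, sub_eq_add_neg]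

/-- The full projector is the sum of the coordinate projectors over a half-system `τ` of the conjugate
pairs (`Λ_W = {λ_{τ ν}}`, the three values distinct). -/
theorem projW_eq_sum_proj1 {x : K} (hx : Separates K x) (τ : Fin 3 → (K ≃ₐ[ℚ] K))
    (hτcov : ∀ g, ∃ ν, g = τ ν ∨ g = (cc K).trans (τ ν))
    (hτdist : ∀ ν ν', τ ν' = τ ν ∨ τ ν' = (cc K).trans (τ ν) → ν' = ν) :
    projW K τ₁ x = ∑ ν, proj1 K τ₁ x (τ ν) := by
  have hLamW : LamW K x = Finset.univ.image fun ν => pairVal K x (τ ν) := by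
    ext y
    simp only [LamW, Finset.mem_image, Finset.mem_univ, true_and]
    constructor
    · rintro ⟨g, rfl⟩
      obtain ⟨ν, hν | hν⟩ := hτcov g
      · exact ⟨ν, by rw [hν]⟩
      · refine ⟨ν, ?_⟩
        rw [hν]
        show τ ν x * ((cc K).trans (τ ν)) x =
          ((cc K).trans (τ ν)) x * ((cc K).trans ((cc K).trans (τ ν))) x
        rw [cc_trans_cc_trans, mul_comm]
    · rintro ⟨ν, rfl⟩
      exact ⟨τ ν, rfl⟩
  have hinj : Function.Injective fun ν => pairVal K x (τ ν) := by
    intro ν ν' h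
    exact (hτdist ν ν' (eq_or_eq_cc_trans_of_pair_eq K hx h)).symm
  unfold projW proj1
  rw [hLamW, Summit.Ventures.HodgeRepro2.A2Galois.lagrangeIndicator,
    Finset.sum_image (fun ν _ ν' _ h => hinj h), Polynomial.map_sum, map_sum]
  refine Finset.sum_congr rfl fun ν _ => ?_
  rw [Summit.Ventures.HodgeRepro2.A2Galois.lagrangeIndicator, Finset.sum_singleton]

end Summit.Ventures.HodgeRepro2.T6.A2Proj

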